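import Literature.MathematicalPhysics.QuantumFieldTheory.Balaban1983to89.B8CubeMemberTorusAverages
import Literature.MathematicalPhysics.QuantumFieldTheory.Balaban1983to89.B8CubeMemberTorusDomainsL0
import Literature.MathematicalPhysics.QuantumFieldTheory.Balaban1983to89.B8Ineq159MultiLevelTorusL0

/-!
# `Balaban1983to89.B8CubeMemberTorusClasses` — TRANSPLANT STEP T3c of the N05 flat road: THE CONSTRAINT CLASSES AND LEVELS OF THE TORUS READING AT THE
# CUBE MEMBER — `Ω_j^{(j)}`, «inside Ω_{j+1}», the bond class `𝔅` of [Balaban1984PropagatorsII] (2.3)∕(2.20) (`B6SectADomainsV1.Domains.LamBond` of r03's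
# `domT`) versus the member's `□_j^{(j)}`, `□_{j+1}^{(j)}` and print's class `cubeLamBP` of [Balaban1985RegularSpaces] (1.31)∕(1.131), under the chart and the shift `t`

statement-level skeleton of published theorems with citation tags; proofs where landed; nothing here is a claim about the
Yang–Mills mass gap

`[Balaban1984PropagatorsII]` (2.1)–(2.4) p. 224 («Ω_j = B^j(Ω_j^{(j)})», «Λ_j = Ω_j^{(j)} ∖ B(Ω_{j+1}^{(j+1)})»), (2.3) p. 224 (the bonds of `B(Λ_j)`), (2.20) p. 226; `[Balaban1985RegularSpaces]`
(1.31) p. 82, (1.131) p. 99 («Λ′_j = □_j^{(j)} ∖ □_{j+1}^{(j)}»), p. 98.  PDF held: `paper:balaban1985-cmp99-regular-spaces-gauge-fixing`.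

CITATION HEADER (lean-in-tree rule).  Cell `pub-ymgap` (YM Track A, HUMAN RULING D-0062), DAG node N05 = [B8], seat `pub-ymgap-dag-n05-c` (g12), `TRANSPLANT-DESIGN.md` step T3c.
WHY THIS FILE.  The torus reading of (1.59) (lit-balaban sub-row G-F3′-L0∕B8) quantifies its averaging datum over the bond class `LamBond` of the V1 domain datum
`domT hN D hk` (r03 `B6GlobalChartV1L0`) of the member `D = cubeTDomainsL0 …` (this seat, T2a), and weights every bond by the level `D.lev` of its source block
(`B8Ineq159MultiLevelTorusL0.len_blkV1`); the member's target `Ineq159FlatCubeMemberPrinted` quantifies its datum over `cubeLamBP … j` (coarse `ℤ^{d+1}` sites) and its weights by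
`SideTouches`∕`BondTouches (□_j)`.  THIS FILE is the dictionary: §1 coarse labels (`labelsJ ∘ iterBlockOf = blockMap ∘ labels`, `labelsJ ∘ blockOf`), §2 the shift at level `j`
(`t = Lʲ·t_j`, `shift_eq_smul_shiftJ`) and blocks of translates, §3 `Ω_j^{(j)}` ∕ «deep» ∕ `LamBond` of `domT` at the member in terms of `□_j^{(j)}`, `□_{j+1}^{(j)}` and
`cubeLamBP` (levels `1 … n`) and the level-`0` reading «both ends off `t + □₁`», §4 the level of a bond's block versus `SideTouches`∕`BondTouches`.

HONEST SCOPE ∕ NOT CLAIMED.  Bookkeeping; no estimate.  Count-neutral; N05 NOT discharged; one finite `T⁴` programme at fixed `ε`, Bałaban as printed; nothing continuum ∕ ℝ⁴ ∕ OS ∕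
mass-gap ∕ Clay.  No `sorry`, no `instance`, no `notation`; one plumbing `def` (`shiftJ`).  Unit `pub-ymgap-dag-n05-c` (g12), 2026-08-28.
-/
noncomputable section

namespace Literature.MathematicalPhysics.QuantumFieldTheory.Balaban1983to89.B8CubeMemberTorusClasses

open B4Reflection242 (boxDom mem_boxDom)
open B6MultiLevelBoxOperator (N0)
open B6GlobalChartV1 (PV toBox toBox_apply)
open B6GlobalChartV1L0 (domT blkV1 iterBlockOf_mem_domT_iff)
open B7Prop1Explicit (e e_apply)
open B7Prop1Local (InBox)
open B8Eq131Cubes (gs cube sqLo sqHi inLo inHi bLo bHi)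
open B8Eq191FlatDirichletDepth (fm loC hiC)
open B8Eq191FlatLettersCubeMember (under_iff_blockMap_eq)
open B8CubeMemberBoxDomains (shift boxP)
open B8CubeMemberBoxDomainsL0 (levL0)
open B8CubeMemberTorusDomainsL0 (cubeTDomainsL0 le_lev_toBox_iff lev_cubeTDomainsL0_toBox)
open B8CubeMemberTorusChart (toTorus labels labels_eq_toBox toTorus_labels labels_nonneg labels_lt shift_eq_toTorus labels_toTorus)
open B8CubeMemberTorusAverages (labelsJ labelsJ_zero exists_iterBlockOf_eq pow_mul_labelsJ_succ_le)
open B8Ineq159FlatCubeMemberPrinted (cubeLamBP mem_cubeLamBP_iff)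
open B5Eq118OneStroke (iterBlockOf iterBlockOf_zero iterBlockOf_succ val_iterBlockOf)
open Literature.MathematicalPhysics.QuantumLattice (blockMap)

variable {d ℓ mV KV : ℕ} {hd : 1 ≤ d + 1} {hL : Odd (ℓ + 1) ∧ 1 < ℓ + 1}

/-! ## §1 Coarse labels: `labelsJ ∘ iterBlockOf = blockMap ∘ labels` -/

/-- **THE COARSE LABELS OF THE ORDER-`j` BLOCK POINT ARE THE `Lʲ`-BLOCK LABELS OF THE LABELS** (both lineages label blocks by `⌊x_μ∕Lʲ⌋`; `B6GlobalChartV1.blk_toBox`).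
[cite: Balaban1984PropagatorsI, (1.6) p.18, (1.18) p.20; Balaban1984PropagatorsII, (2.1) p.224, dictionary] -/
theorem labelsJ_iterBlockOf {j : ℕ} (hj : j ≤ mV + KV) (x : Site (PV d ℓ mV KV hd hL) 0) :
    labelsJ (iterBlockOf j x) = blockMap ((ℓ + 1) ^ j) (labels x) := by
  funext μ
  show (((iterBlockOf j x) μ).val : ℤ) = ((x μ).val : ℤ) / (((ℓ + 1) ^ j : ℕ) : ℤ)
  rw [val_iterBlockOf j hj, Int.natCast_div]

/-- one block step on coarse labels: `labelsJ (blockOf y) = blockMap L (labelsJ y)`. [cite: Balaban1984PropagatorsI, (1.6) p.18, dictionary] -/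
theorem labelsJ_blockOf {j : ℕ} (hj : j + 1 ≤ mV + KV) (y : Site (PV d ℓ mV KV hd hL) j) :
    labelsJ (blockOf y) = blockMap (ℓ + 1) (labelsJ y) := by
  funext μ
  show (((blockOf y) μ).val : ℤ) = ((y μ).val : ℤ) / ((ℓ + 1 : ℕ) : ℤ)
  rw [Site.val_blockOf hj, Int.natCast_div]

/-- coarse shift without wrap-around: `labelsJ (y.shift μ) = labelsJ y + e_μ` when `labelsJ y μ + 1 < N∕Lʲ`. [cite: Balaban1984PropagatorsI, (1.2) p.18, dictionary] -/
theorem labelsJ_shift_of_lt {j : ℕ} (y : Site (PV d ℓ mV KV hd hL) j) (μ : Fin (d + 1))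
    (h : labelsJ y μ + 1 < ((PV d ℓ mV KV hd hL).sitesPerDir j : ℕ)) : labelsJ (y.shift μ) = labelsJ y + e μ := by
  funext ν
  simp only [labelsJ, Site.shift, Function.update_apply, Pi.add_apply, e_apply]
  split_ifs with hν
  · subst hν
    have h' : (y ν).val + 1 < (PV d ℓ mV KV hd hL).sitesPerDir j := by
      have := h; simp only [labelsJ] at this; exact_mod_cast this
    rw [ZMod.val_add_of_lt (by rw [ZMod.val_one]; exact h'), ZMod.val_one]
    push_cast; ring
  · simp

/-! ## §2 The shift at level `j` and the blocks of translated labels -/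

/-- **THE SHIFT AT LEVEL `j`**: `t_j = M_hL^{n+1−j}ρ − L^{k−j}a + L^{n−j}·m_n∕Lⁿ`, so that `t = Lʲ·t_j` for `j ≤ n ≤ k` (F1's `shift`, all of whose summands are multiples of `Lⁿ`).
[cite: Balaban1985RegularSpaces, p.98 («□_j is a sum of the big blocks of the lattice T_{L^{−j}}»); Balaban1984PropagatorsII, (2.1) p.224, dictionary] -/
def shiftJ (ℓ Mh : ℕ) (a : Fin (d + 1) → ℤ) (ρ k n j : ℕ) : Fin (d + 1) → ℤ := fun i =>
  ((Mh * (ℓ + 1) ^ (n + 1 - j) * ρ : ℕ) : ℤ) - (((ℓ + 1) ^ (k - j) : ℕ) : ℤ) * a i + (((ℓ + 1) ^ (n - j) * (ρ * gs (ℓ + 1) (k - n)) : ℕ) : ℤ)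

/-- **`t = Lʲ·t_j`** (`j ≤ n ≤ k`). [cite: Balaban1985RegularSpaces, p.98; Balaban1984PropagatorsII, (2.1) p.224, dictionary] -/
theorem shift_eq_smul_shiftJ (ℓ Mh : ℕ) (a : Fin (d + 1) → ℤ) {ρ k n j : ℕ} (hjn : j ≤ n) (hnk : n ≤ k) :
    shift ℓ Mh a ρ k n = (((ℓ + 1) ^ j : ℕ) : ℤ) • shiftJ ℓ Mh a ρ k n j := by
  funext i
  simp only [shift, shiftJ, loC, bLo, fm, Pi.smul_apply, smul_eq_mul]
  have e1 : ((ℓ : ℤ) + 1) ^ (n + 1) = ((ℓ : ℤ) + 1) ^ j * ((ℓ : ℤ) + 1) ^ (n + 1 - j) := by rw [← pow_add]; congr 1; omega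
  have e2 : ((ℓ : ℤ) + 1) ^ k = ((ℓ : ℤ) + 1) ^ j * ((ℓ : ℤ) + 1) ^ (k - j) := by rw [← pow_add]; congr 1; omega
  have e3 : ((ℓ : ℤ) + 1) ^ n = ((ℓ : ℤ) + 1) ^ j * ((ℓ : ℤ) + 1) ^ (n - j) := by rw [← pow_add]; congr 1; omega
  push_cast
  rw [e1, e2, e3]
  ring

/-- `blockMap N (y − N·v) = blockMap N y − v`. [folklore] [cite: Balaban1984PropagatorsI, (1.6) p.18, dictionary] -/
theorem blockMap_sub_smul {N : ℕ} (hN : 0 < N) (y v : Fin (d + 1) → ℤ) : blockMap N (y - (N : ℤ) • v) = blockMap N y - v := by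
  funext i
  have hN' : (N : ℤ) ≠ 0 := by exact_mod_cast hN.ne'
  simp only [blockMap, Pi.sub_apply, Pi.smul_apply, smul_eq_mul]
  rw [show y i - (N : ℤ) * v i = y i + (-v i) * N by ring, Int.add_mul_ediv_right _ _ hN']
  ring

/-- **THE `Lʲ`-BLOCK OF A TRANSLATED LABEL VECTOR**: `blockMap (Lʲ) (labels x − t) = labelsJ (iterBlockOf j x) − t_j` (`j ≤ n ≤ k`, `j ≤ m + K`).
[cite: Balaban1984PropagatorsII, (2.1) p.224; Balaban1985RegularSpaces, p.98, dictionary] -/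
theorem blockMap_labels_sub_shift {Mh : ℕ} (a : Fin (d + 1) → ℤ) {ρ k n j : ℕ} (hj : j ≤ mV + KV) (hjn : j ≤ n) (hnk : n ≤ k)
    (x : Site (PV d ℓ mV KV hd hL) 0) :
    blockMap ((ℓ + 1) ^ j) (labels x - shift ℓ Mh a ρ k n) = labelsJ (iterBlockOf j x) - shiftJ ℓ Mh a ρ k n j := by
  rw [shift_eq_smul_shiftJ ℓ Mh a hjn hnk, blockMap_sub_smul (pow_pos (Nat.succ_pos ℓ) j), labelsJ_iterBlockOf hj]

/-- **BLOW-UP BOXES READ ON BLOCK LABELS**: `w ∈ [L·lo, L·(hi+1) − 1] ↔ blockMap L w ∈ [lo, hi]`. [folklore] [cite: Balaban1985RegularSpaces, p.98 («□_j is a sum of the big blocks»), dictionary] -/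
theorem inBox_blowup_iff_blockMap {L : ℕ} (hL : 0 < L) (lo hi w : Fin (d + 1) → ℤ) :
    InBox (B8Ineq130.tlo L lo 1) (B8Ineq130.thi L hi 1) w ↔ InBox lo hi (blockMap L w) := by
  have hL' : (0 : ℤ) < (L : ℤ) := by exact_mod_cast hL
  refine forall_congr' fun i => ?_
  rw [B8Ineq130.tlo_apply, B8Ineq130.thi_apply, pow_one]
  simp only [blockMap]
  constructor
  · rintro ⟨h1, h2⟩
    exact ⟨(Int.le_ediv_iff_mul_le hL').2 (by linarith), by
      have := Int.ediv_lt_iff_lt_mul hL' |>.2 (show w i < (hi i + 1) * L by linarith); omega⟩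
  · rintro ⟨h1, h2⟩
    have h1' := (Int.le_ediv_iff_mul_le hL').1 h1
    have h2' : w i / (L : ℤ) < hi i + 1 := by omega
    have h2'' := (Int.ediv_lt_iff_lt_mul hL').1 h2'
    constructor <;> linarith

/-- `□_j` read on `Lʲ`-block labels: `w ∈ □_j ↔ blockMap (Lʲ) w ∈ □_j^{(j)}` (`L ≥ 1`). [cite: Balaban1985RegularSpaces, p.98 («□_j is a sum of the big blocks of the lattice T_{L^{−j}}»), (1.131) p.99] -/
theorem mem_cube_iff_blockMap {L : ℕ} (hL : 1 ≤ L) {a : Fin (d + 1) → ℤ} {M ρ k j : ℕ} (w : Fin (d + 1) → ℤ) :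
    w ∈ cube L a M ρ k j ↔ InBox (sqLo L a ρ k j) (sqHi L a M ρ k j) (blockMap (L ^ j) w) := by
  rw [B8Eq131Cubes.mem_cube_iff hL]
  constructor
  · rintro ⟨z, hz, hu⟩
    rwa [(under_iff_blockMap_eq hL j z w).1 hu]
  · intro h
    exact ⟨_, h, (under_iff_blockMap_eq hL j _ w).2 rfl⟩

/-! ## §3 `Ω_j^{(j)}`, «deep» and `LamBond` of `domT` at the cube member -/

section Member

variable {Mh : ℕ} (hℓ : 1 ≤ ℓ) (hMh : 2 ≤ Mh) (a : Fin (d + 1) → ℤ) {M ρ k n R : ℕ} (hn : 1 ≤ n) (hnk : n ≤ k)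
  (hρ : Mh * (ℓ + 1) ∣ ρ) (hM : Mh * (ℓ + 1) ∣ M) (hρ0 : 0 < ρ) (hR : R * (Mh * (ℓ + 1)) ≤ ρ)
  {P : Fin (d + 1) → ℕ} (hfit : ∀ μ, boxP ℓ M ρ k n μ ≤ P μ) (hN : ∀ μ, N0 ℓ Mh n P μ = (PV d ℓ mV KV hd hL).sitesPerDir 0) (hk : n ≤ mV + KV)

/-- **`Ω_j^{(j)}` OF THE TORUS READING IS `t_j + □_j^{(j)}`** (`1 ≤ j ≤ n`): a coarse site `y` of `T^{(j)}` belongs to `(domT hN D hk).Om j` for `D = cubeTDomainsL0 …` iff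
`labelsJ y − t_j ∈ [sqLo j, sqHi j]`. [cite: Balaban1984PropagatorsII, (2.1) p.224 («Ω_j = B^j(Ω_j^{(j)})»); Balaban1985RegularSpaces, p.98, (1.131) p.99] -/
theorem mem_Om_iff {j : ℕ} (hj1 : 1 ≤ j) (hjn : j ≤ n) (y : Site (PV d ℓ mV KV hd hL) j) :
    y ∈ (domT hN (cubeTDomainsL0 hℓ hMh a hn hnk hρ hM hρ0 hR P hfit) hk).Om j ↔
      InBox (sqLo (ℓ + 1) a ρ k j) (sqHi (ℓ + 1) a M ρ k j) (labelsJ y - shiftJ ℓ Mh a ρ k n j) := by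
  have hj : j ≤ mV + KV := hjn.trans hk
  obtain ⟨x, rfl⟩ := exists_iterBlockOf_eq hj y
  rw [iterBlockOf_mem_domT_iff hN _ hk hjn x, le_lev_toBox_iff hℓ hMh a hn hnk hρ hM hρ0 hR hfit hN hj1 hjn x,
    mem_cube_iff_blockMap (Nat.succ_pos ℓ), ← blockMap_labels_sub_shift a hj hjn hnk x]
  rfl

/-- `Ω_j^{(j)} = ∅` above the truncation (`n < j`). [cite: Balaban1984PropagatorsII, (2.1) p.224, dictionary] -/
theorem Om_eq_empty_of_lt {j : ℕ} (hj : n < j) :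
    (domT hN (cubeTDomainsL0 hℓ hMh a hn hnk hρ hM hρ0 hR P hfit) hk).Om j = ∅ :=
  (domT hN (cubeTDomainsL0 hℓ hMh a hn hnk hρ hM hρ0 hR P hfit) hk).Om_eq_empty hj

/-- **«DEEP» IS «INSIDE `t_j + □_{j+1}^{(j)}`»** (`j < n`): `Deep j y ↔ labelsJ y − t_j ∈ [inLo j, inHi j]`.
[cite: Balaban1984PropagatorsII, (2.3)–(2.4) p.224 («Λ_j = Ω_j^{(j)} ∖ B(Ω_{j+1}^{(j+1)})»); Balaban1985RegularSpaces, (1.131) p.99] -/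
theorem deep_iff_of_lt {j : ℕ} (hjn : j < n) (y : Site (PV d ℓ mV KV hd hL) j) :
    (domT hN (cubeTDomainsL0 hℓ hMh a hn hnk hρ hM hρ0 hR P hfit) hk).Deep j y ↔
      InBox (inLo (ℓ + 1) a ρ k j) (inHi (ℓ + 1) a M ρ k j) (labelsJ y - shiftJ ℓ Mh a ρ k n j) := by
  have hj1 : j + 1 ≤ mV + KV := by omega
  show blockOf y ∈ _ ↔ _
  rw [mem_Om_iff hℓ hMh a hn hnk hρ hM hρ0 hR hfit hN hk (Nat.succ_pos j) hjn, labelsJ_blockOf hj1]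
  obtain ⟨h1, h2⟩ := B8Eq131Cubes.inner_eq_blowup (L := ℓ + 1) a M ρ (lt_of_lt_of_le hjn hnk)
  rw [h1, h2, inBox_blowup_iff_blockMap (Nat.succ_pos ℓ)]
  have hs : shiftJ ℓ Mh a ρ k n j = ((ℓ + 1 : ℕ) : ℤ) • shiftJ ℓ Mh a ρ k n (j + 1) := by
    funext i
    simp only [shiftJ, Pi.smul_apply, smul_eq_mul]
    have e1 : (ℓ + 1) ^ (n + 1 - j) = (ℓ + 1) * (ℓ + 1) ^ (n + 1 - (j + 1)) := by rw [← pow_succ']; congr 1; omega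
    have e2 : (ℓ + 1) ^ (k - j) = (ℓ + 1) * (ℓ + 1) ^ (k - (j + 1)) := by rw [← pow_succ']; congr 1; omega
    have e3 : (ℓ + 1) ^ (n - j) = (ℓ + 1) * (ℓ + 1) ^ (n - (j + 1)) := by rw [← pow_succ']; congr 1; omega
    rw [e1, e2, e3]
    push_cast
    ring
  rw [hs, blockMap_sub_smul (Nat.succ_pos ℓ)]

/-- nothing is deep at the top level `n`. [cite: Balaban1984PropagatorsII, (2.3) p.224 («Λ_k = Ω_k^{(k)}»), dictionary] -/
theorem not_deep_top (y : Site (PV d ℓ mV KV hd hL) n) : ¬ (domT hN (cubeTDomainsL0 hℓ hMh a hn hnk hρ hM hρ0 hR P hfit) hk).Deep n y := by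
  show blockOf y ∉ _
  rw [Om_eq_empty_of_lt hℓ hMh a hn hnk hρ hM hρ0 hR hfit hN hk (Nat.lt_succ_self n)]
  exact Finset.notMem_empty _

/-- **AT LEVEL `0`, «DEEP» IS «IN `t + □₁`»**: `Deep 0 y ↔ labels y − t ∈ □₁`. [cite: Balaban1984PropagatorsII, (2.3) p.224 («Λ₀ = Ω₁ᶜ»); Balaban1985RegularSpaces, (1.131) p.99 («Λ′₀ = T ∖ □₁»)] -/
theorem deep_zero_iff (y : Site (PV d ℓ mV KV hd hL) 0) :
    (domT hN (cubeTDomainsL0 hℓ hMh a hn hnk hρ hM hρ0 hR P hfit) hk).Deep 0 y ↔ labels y - shift ℓ Mh a ρ k n ∈ cube (ℓ + 1) a M ρ k 1 := by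
  show blockOf y ∈ _ ↔ _
  have h := iterBlockOf_mem_domT_iff hN (cubeTDomainsL0 hℓ hMh a hn hnk hρ hM hρ0 hR P hfit) hk hn y
  rw [iterBlockOf_succ, iterBlockOf_zero] at h
  rw [h, le_lev_toBox_iff hℓ hMh a hn hnk hρ hM hρ0 hR hfit hN le_rfl hn y]
  rfl

/-- **A SITE OF `Ω_j^{(j)}` IS AWAY FROM THE SEAM OF THE COARSE TORUS** (`1 ≤ j ≤ n`): `1 ≤ labelsJ y μ` and `labelsJ y μ + 2 ≤ N∕Lʲ` — its block lies in `t + □₀`, which is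
`ρLⁿ`-deep (`B8CubeMemberTorusDomainsL0.siteDeep_shift_of_mem_cube_zero`), and `ρLⁿ ≥ 2Lʲ`. [cite: Balaban1984PropagatorsII, (2.1) p.224; Balaban1985RegularSpaces, p.98, dictionary] -/
theorem labelsJ_bounds_of_mem_Om {j : ℕ} (hj1 : 1 ≤ j) (hjn : j ≤ n) {y : Site (PV d ℓ mV KV hd hL) j}
    (hy : y ∈ (domT hN (cubeTDomainsL0 hℓ hMh a hn hnk hρ hM hρ0 hR P hfit) hk).Om j) (μ : Fin (d + 1)) :
    1 ≤ labelsJ y μ ∧ labelsJ y μ + 2 ≤ ((PV d ℓ mV KV hd hL).sitesPerDir j : ℕ) := by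
  have hj : j ≤ mV + KV := hjn.trans hk
  have hMh1 : 1 ≤ Mh := le_trans (by norm_num) hMh
  have hρL : ℓ + 1 ≤ ρ := le_trans (Nat.le_mul_of_pos_left _ hMh1) (Nat.le_of_dvd hρ0 hρ)
  obtain ⟨x, rfl⟩ := exists_iterBlockOf_eq hj y
  -- the fine site `x` lies over `y`, and its translate is in `□_j ⊂ □₀`
  have hlev := (iterBlockOf_mem_domT_iff hN _ hk hjn x).1 hy
  have hcube := (le_lev_toBox_iff hℓ hMh a hn hnk hρ hM hρ0 hR hfit hN hj1 hjn x).1 hlev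
  have hcube0 : (fun μ => ((x μ).val : ℤ)) - shift ℓ Mh a ρ k n ∈ cube (ℓ + 1) a M ρ k 0 :=
    B8Eq131Cubes.cube_anti (Nat.zero_le j) (hjn.trans hnk) hcube
  have hdeep := B8CubeMemberTorusDomainsL0.siteDeep_shift_of_mem_cube_zero hℓ hMh a hn hnk hfit hcube0 μ
  rw [sub_add_cancel] at hdeep
  obtain ⟨h1, h2⟩ := hdeep
  rw [hN μ] at h2
  -- `ρLⁿ ≥ 2Lʲ`
  have hLj : 0 < (ℓ + 1) ^ j := pow_pos (Nat.succ_pos ℓ) j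
  have hw : 2 * (ℓ + 1) ^ j ≤ ρ * (ℓ + 1) ^ n := by
    have g1 : 2 * (ℓ + 1) ^ j ≤ 2 * (ℓ + 1) ^ n := Nat.mul_le_mul_left _ (Nat.pow_le_pow_right (Nat.succ_pos ℓ) hjn)
    have g2 : 2 * (ℓ + 1) ^ n ≤ ρ * (ℓ + 1) ^ n := Nat.mul_le_mul_right _ (by omega)
    exact g1.trans g2
  -- the period of `T^{(j)}` is `N ∕ Lʲ`
  have hNj : ((PV d ℓ mV KV hd hL).sitesPerDir 0 : ℕ) = (ℓ + 1) ^ j * (PV d ℓ mV KV hd hL).sitesPerDir j := by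
    simp only [Params.sitesPerDir, Nat.sub_zero]
    show 2 * (ℓ + 1) ^ (mV + KV) = (ℓ + 1) ^ j * (2 * (ℓ + 1) ^ (mV + KV - j))
    rw [mul_left_comm, ← pow_add, Nat.add_sub_cancel' hj]
  have hval := val_iterBlockOf j hj x μ
  -- integer-division arithmetic, in `ℕ`
  have hx1 : (ℓ + 1) ^ j * ((iterBlockOf j x) μ).val ≤ (x μ).val := by
    rw [hval, mul_comm]; exact Nat.div_mul_le_self _ _
  have hx2 : (x μ).val < (ℓ + 1) ^ j * (((iterBlockOf j x) μ).val + 1) := by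
    have h := Nat.lt_div_mul_add (a := (x μ).val) hLj
    have hv : ((iterBlockOf j x) μ).val = (x μ).val / (ℓ + 1) ^ j := hval
    rw [hv, mul_add, mul_one, mul_comm]
    exact h
  have h1n : ρ * (ℓ + 1) ^ n ≤ (x μ).val := by exact_mod_cast h1
  have h2n : (x μ).val + ρ * (ℓ + 1) ^ n ≤ (ℓ + 1) ^ j * (PV d ℓ mV KV hd hL).sitesPerDir j := by rw [← hNj]; exact_mod_cast h2
  have hc1 : 1 ≤ ((iterBlockOf j x) μ).val := by
    by_contra h0
    push Not at h0
    have : (ℓ + 1) ^ j * (((iterBlockOf j x) μ).val + 1) ≤ (ℓ + 1) ^ j * 1 := Nat.mul_le_mul_left _ (by omega)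
    omega
  have hc2 : ((iterBlockOf j x) μ).val + 2 ≤ (PV d ℓ mV KV hd hL).sitesPerDir j := by
    have : (ℓ + 1) ^ j * (((iterBlockOf j x) μ).val + 2) ≤ (ℓ + 1) ^ j * (PV d ℓ mV KV hd hL).sitesPerDir j := by nlinarith
    exact Nat.le_of_mul_le_mul_left this hLj
  simp only [labelsJ]
  exact ⟨by exact_mod_cast hc1, by exact_mod_cast hc2⟩

/-- **ON A BOND OF `𝔅` THE COARSE TARGET LABEL IS THE SOURCE LABEL PLUS `e_μ`** (`1 ≤ j ≤ n`; no wrap-around, by `labelsJ_bounds_of_mem_Om`).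
[cite: Balaban1984PropagatorsII, (2.3) p.224, (2.20) p.226, dictionary] -/
theorem labelsJ_tgt_of_lamBond {j : ℕ} (hj1 : 1 ≤ j) (hjn : j ≤ n) {b : PBond (PV d ℓ mV KV hd hL) j}
    (hb : (domT hN (cubeTDomainsL0 hℓ hMh a hn hnk hρ hM hρ0 hR P hfit) hk).LamBond j b) : labelsJ b.tgt = labelsJ b.src + e b.dir := by
  obtain ⟨hends, -, -⟩ := hb
  rcases hends with hsrc | htgt
  · have h := labelsJ_bounds_of_mem_Om hℓ hMh a hn hnk hρ hM hρ0 hR hfit hN hk hj1 hjn hsrc b.dir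
    exact labelsJ_shift_of_lt b.src b.dir (by omega)
  · -- the target is away from the seam, so the source label is the target label minus one
    have h := labelsJ_bounds_of_mem_Om hℓ hMh a hn hnk hρ hM hρ0 hR hfit hN hk hj1 hjn htgt b.dir
    refine labelsJ_shift_of_lt b.src b.dir ?_
    -- `labelsJ (src.shift dir) dir = (labelsJ src dir + 1) mod N_j ≥ 1` rules out the wrap
    have hval : ((b.tgt b.dir).val : ℤ) = (((b.src b.dir).val + 1 : ℕ) : ℤ) % ((PV d ℓ mV KV hd hL).sitesPerDir j : ℕ) := by
      show (((b.src.shift b.dir) b.dir).val : ℤ) = _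
      simp only [Site.shift, Function.update_self]
      rw [ZMod.val_add, ZMod.val_one]
      push_cast
      rfl
    have hlt : ((b.src b.dir).val : ℤ) < ((PV d ℓ mV KV hd hL).sitesPerDir j : ℕ) := by exact_mod_cast ZMod.val_lt _
    have h1 : (1 : ℤ) ≤ ((b.tgt b.dir).val : ℤ) := h.1
    simp only [labelsJ]
    by_contra hge
    push Not at hge
    have heq : ((b.src b.dir).val : ℤ) + 1 = ((PV d ℓ mV KV hd hL).sitesPerDir j : ℕ) := by omega
    rw [hval] at h1
    push_cast at h1
    rw [heq, Int.emod_self] at h1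
    exact absurd h1 (by norm_num)

/-- ★ **THE BOND CLASS `𝔅` OF THE TORUS READING AT THE MEMBER IS PRINT's CLASS `cubeLamBP`** (`1 ≤ j ≤ n`): a coarse bond `b` of `T^{(j)}` is a `LamBond` of `domT hN D hk`,
`D = cubeTDomainsL0 …`, iff `(labelsJ b₋ − t_j, dir b) ∈ cubeLamBP (ℓ+1) a M ρ k n j` — inner bonds of `Λ_j` AND the crossing bonds of (1.31)∕[B6] (2.3).
[cite: Balaban1984PropagatorsII, (2.3) p.224, (2.20) p.226; Balaban1985RegularSpaces, (1.31) p.82, (1.131) p.99] -/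
theorem lamBond_iff {j : ℕ} (hj1 : 1 ≤ j) (hjn : j ≤ n) (b : PBond (PV d ℓ mV KV hd hL) j) (htgt : labelsJ b.tgt = labelsJ b.src + e b.dir) :
    (domT hN (cubeTDomainsL0 hℓ hMh a hn hnk hρ hM hρ0 hR P hfit) hk).LamBond j b ↔
      (labelsJ b.src - shiftJ ℓ Mh a ρ k n j, b.dir) ∈ cubeLamBP (ℓ + 1) a M ρ k n j := by
  rw [mem_cubeLamBP_iff]
  unfold B6SectADomainsV1.Domains.LamBond
  rw [mem_Om_iff hℓ hMh a hn hnk hρ hM hρ0 hR hfit hN hk hj1 hjn, mem_Om_iff hℓ hMh a hn hnk hρ hM hρ0 hR hfit hN hk hj1 hjn, htgt]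
  have hsub : labelsJ b.src + e b.dir - shiftJ ℓ Mh a ρ k n j = labelsJ b.src - shiftJ ℓ Mh a ρ k n j + e b.dir := by abel
  rw [hsub]
  simp only
  rcases Nat.lt_or_ge j n with hlt | hge
  · rw [deep_iff_of_lt hℓ hMh a hn hnk hρ hM hρ0 hR hfit hN hk hlt, deep_iff_of_lt hℓ hMh a hn hnk hρ hM hρ0 hR hfit hN hk hlt, htgt, hsub]
    exact ⟨fun ⟨h1, h2, h3⟩ => ⟨hjn, h1, fun _ => ⟨h2, h3⟩⟩, fun ⟨_, h1, h23⟩ => ⟨h1, (h23 hlt).1, (h23 hlt).2⟩⟩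
  · have hjn' : j = n := le_antisymm hjn hge
    subst hjn'
    have hn1 := not_deep_top hℓ hMh a hn hnk hρ hM hρ0 hR hfit hN hk b.src
    have hn2 := not_deep_top hℓ hMh a hn hnk hρ hM hρ0 hR hfit hN hk b.tgt
    exact ⟨fun ⟨h1, _, _⟩ => ⟨le_rfl, h1, fun h => absurd h (lt_irrefl _)⟩, fun ⟨_, h1, _⟩ => ⟨h1, hn1, hn2⟩⟩

/-- **THE LEVEL-`0` CLASS OF THE TORUS READING**: a fine bond is a level-`0` `LamBond` iff NEITHER end lies in `t + □₁` (`Ω₀ = T_η`, «Λ₀ = Ω₁ᶜ»).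
[cite: Balaban1984PropagatorsII, (2.3) p.224 («Λ₀ = Ω₁ᶜ»), (2.6)∕(2.20) p.224∕226 («A = B₀ on Λ₀»); Balaban1985RegularSpaces, (1.131) p.99 («Λ′₀ = T ∖ □₁»)] -/
theorem lamBond_zero_iff (b : PBond (PV d ℓ mV KV hd hL) 0) :
    (domT hN (cubeTDomainsL0 hℓ hMh a hn hnk hρ hM hρ0 hR P hfit) hk).LamBond 0 b ↔
      labels b.src - shift ℓ Mh a ρ k n ∉ cube (ℓ + 1) a M ρ k 1 ∧ labels b.tgt - shift ℓ Mh a ρ k n ∉ cube (ℓ + 1) a M ρ k 1 := by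
  unfold B6SectADomainsV1.Domains.LamBond
  rw [deep_zero_iff hℓ hMh a hn hnk hρ hM hρ0 hR hfit hN hk, deep_zero_iff hℓ hMh a hn hnk hρ hM hρ0 hR hfit hN hk]
  have h0 : b.src ∈ (domT hN (cubeTDomainsL0 hℓ hMh a hn hnk hρ hM hρ0 hR P hfit) hk).Om 0 := by
    rw [(domT hN (cubeTDomainsL0 hℓ hMh a hn hnk hρ hM hρ0 hR P hfit) hk).Om_zero]; exact Finset.mem_univ _
  exact ⟨fun ⟨_, h1, h2⟩ => ⟨h1, h2⟩, fun ⟨h1, h2⟩ => ⟨Or.inl h0, h1, h2⟩⟩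

/-! ## §4 The level of a bond's block -/

/-- **THE WEIGHT OF A FINE BOND IS `L^{lev}` WITH `lev = levL0 (labels b₋)`** (`B8Ineq159MultiLevelTorusL0.len_blkV1` at the member).
[cite: Balaban1984PropagatorsII, (2.45)–(2.46) p.231; Balaban1985RegularSpaces, p.86 («|A|₍α₎ = sup_j sup_{Ω_j}(Lʲη)^{−α}|A|»)] -/
theorem len_blkV1_member (b : PBond (PV d ℓ mV KV hd hL) 0) :
    (B6Geom246MultiLevelTorusL0.geomT (cubeTDomainsL0 hℓ hMh a hn hnk hρ hM hρ0 hR P hfit)).len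
        (blkV1 hN (cubeTDomainsL0 hℓ hMh a hn hnk hρ hM hρ0 hR P hfit) b) =
      ((ℓ : ℝ) + 1) ^ levL0 ℓ Mh a M ρ k n (labels b.src) := by
  rw [B8Ineq159MultiLevelTorusL0.len_blkV1 hN]
  rfl

end Member

/-- **THE LEVEL OF A FINE SITE**: `j ≤ levL0 (labels x) ↔ labels x − t ∈ □_j` for `1 ≤ j ≤ n`, and `levL0 (labels x) ≤ n`. [cite: Balaban1984PropagatorsII, (2.3)–(2.4) p.224; Balaban1985RegularSpaces, (1.131) p.99] -/
theorem le_levL0_labels_iff {Mh : ℕ} (a : Fin (d + 1) → ℤ) (M : ℕ) {ρ k n j : ℕ} (hρL : ℓ + 1 ≤ ρ) (hnk : n ≤ k) (hj1 : 1 ≤ j) (hjn : j ≤ n)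
    (x : Site (PV d ℓ mV KV hd hL) 0) :
    j ≤ levL0 ℓ Mh a M ρ k n (labels x) ↔ labels x - shift ℓ Mh a ρ k n ∈ cube (ℓ + 1) a M ρ k j :=
  B8CubeMemberBoxDomainsL0.le_levL0_iff a M hρL hnk hj1 hjn _


end Literature.MathematicalPhysics.QuantumFieldTheory.Balaban1983to89.B8CubeMemberTorusClasses
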